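import Summits.Ventures.HodgeRepro2.T5SU11ResolventL2NeumannAll

/-!
# The resolvent is continuous in the spectral parameter in `L²(sinh 2t dt)` for every square-integrable source

Row 555's Lipschitz bound `‖G^I_λ g − G^I_{λ₂} g‖₂² ≤ (μ − μ₂)² ‖g‖₂²/((λ − 1)⁴ (λ₂ − 1)⁴)` holds for every `λ > 1` with
`2 − λ < ε` — a condition satisfied by every `λ` near `λ₂` — and its right-hand side is continuous in `λ` and vanishes at
`λ₂`; hence

* `tendsto_integral_sinh_mul_sub_sq_all` — **`‖G^I_λ g − G^I_{λ₂} g‖₂² → 0` as `λ → λ₂`** for every `λ₂ > 1` and every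
  square-integrable source of the class: `λ ↦ G^I_λ g` is continuous into `L²(sinh 2t dt)` on `(1, ∞)`
  (row 534's `tendsto_integral_sinh_mul_sub_sq` needed the rate `ε > 1`).

Nothing is claimed about (N).

Blind lane: Mathlib + the HodgeRepro2 prefix only; no sorry; axioms ⊆ {propext, Classical.choice,
Quot.sound}.
-/

namespace Summit.Ventures.HodgeRepro2.T5SU11ResolventL2ContinuityAll

open Filter Topology MeasureTheory
open Set (Ioi Ioc)
open T5SU11Cartan T5SU11SphericalFunction T5SU11SphericalDecay T5SU11RadialGreenImproper T5SU11ResolventL2NeumannAll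

section measure

variable [MeasurableSpace Circle] [BorelSpace Circle]

variable {lam₂ : ℝ} (hlam₂ : 1 < lam₂) {g : ℝ → ℝ} (hg : ContinuousOn g (Ioi 0))
  {M : ℝ} (hM : ∀ s ∈ Ioc (0 : ℝ) 1, |g s| ≤ M) (hM0 : 0 ≤ M)
  {ε C s₀ : ℝ} (hε₂ : 2 - lam₂ < ε) (hC : ∀ s, s₀ ≤ s → |g s| ≤ C * Real.exp (-ε * s))
  (hg2 : IntegrableOn (fun s => Real.sinh (2 * s) * g s ^ 2) (Ioi 0))

include hlam₂ hg hM hM0 hε₂ hC hg2 in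
/-- **THE RESOLVENT IS CONTINUOUS INTO `L²(sinh 2t dt)` IN THE SPECTRAL PARAMETER** for every square-integrable source of
the class: `∫ sinh 2t (G^I_λ g − G^I_{λ₂} g)² → 0` as `λ → λ₂ > 1`. -/
theorem tendsto_integral_sinh_mul_sub_sq_all :
    Tendsto (fun l => ∫ t in Ioi 0, Real.sinh (2 * t) * (greenSolI (fun t => sph l (hyp t)) (sphDecay l) g t
        - greenSolI (fun t => sph lam₂ (hyp t)) (sphDecay lam₂) g t) ^ 2) (𝓝 lam₂) (𝓝 0) := by
  have hp2 : 0 < ((lam₂ - 1) ^ 2) ^ 2 := by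
    have : 0 < lam₂ - 1 := by linarith
    positivity
  -- the bound `(μ(l) − μ₂)² ‖g‖²/((l − 1)⁴ (λ₂ − 1)⁴)` is continuous at `λ₂` and vanishes there
  have hc : ContinuousAt (fun l : ℝ => (l * (l - 2) - lam₂ * (lam₂ - 2)) ^ 2
      * (∫ t in Ioi 0, Real.sinh (2 * t) * g t ^ 2) / (((l - 1) ^ 2) ^ 2 * ((lam₂ - 1) ^ 2) ^ 2)) lam₂ := by
    apply ContinuousAt.div
    · exact (((continuousAt_id.mul (continuousAt_id.sub continuousAt_const)).sub continuousAt_const).pow 2).mul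
        continuousAt_const
    · exact (((continuousAt_id.sub continuousAt_const).pow 2).pow 2).mul continuousAt_const
    · positivity
  have hbound : Tendsto (fun l : ℝ => (l * (l - 2) - lam₂ * (lam₂ - 2)) ^ 2
      * (∫ t in Ioi 0, Real.sinh (2 * t) * g t ^ 2) / (((l - 1) ^ 2) ^ 2 * ((lam₂ - 1) ^ 2) ^ 2)) (𝓝 lam₂) (𝓝 0) := by
    have h := hc.tendsto
    simpa only [sub_self, ne_eq, OfNat.ofNat_ne_zero, not_false_eq_true, zero_pow, zero_mul, zero_div] using h
  -- squeeze between `0` and the bound, eventually near `λ₂` (where `l > 1` and `2 − l < ε`)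
  refine tendsto_of_tendsto_of_tendsto_of_le_of_le' tendsto_const_nhds hbound ?_ ?_
  · exact Eventually.of_forall fun l => setIntegral_nonneg measurableSet_Ioi (fun t ht =>
      mul_nonneg (Real.sinh_nonneg_iff.mpr (by linarith [Set.mem_Ioi.mp ht])) (sq_nonneg _))
  · have h1 : ∀ᶠ l in 𝓝 lam₂, 1 < l := eventually_gt_nhds hlam₂
    have h2 : ∀ᶠ l in 𝓝 lam₂, 2 - ε < l := eventually_gt_nhds (by linarith)
    filter_upwards [h1, h2] with l hl1 hl2
    exact integral_sinh_mul_sub_sq_le_all hl1 hg hM hM0 (by linarith) hC hg2 hlam₂ hε₂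

end measure

end Summit.Ventures.HodgeRepro2.T5SU11ResolventL2ContinuityAll
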